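import Literature.Geometry.Lorentzian.KerrSchildLapseShift
import Mathlib.Analysis.SpecialFunctions.Sqrt
import HarnessLib

/-!
# The explicit smooth square root of the inverse slice metric of a generalised Kerr–Schild
# background (family `gr`; infrastructure for the discharge of the named fact
# `KerrSchild.waveCauchyProblem`)

For a generalised Kerr–Schild background `B` on `ℝ⁴` (`KerrSchild.Background`,
`g⁻¹ = η⁻¹ − φ ℓ♯ ⊗ ℓ♯`) the inverse slice metric `h = (g_t)^{ij} = δ − c ℓ⃗ ⊗ ℓ⃗`,
`c = φ/(1 + φ)` (`Background.sliceInvMetric`, `KerrSchildLapseShift.lean`), is a rank-one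
perturbation of the identity with the single non-trivial eigenvalue `1 − c = 1/(1 + φ) = N²`, so
it satisfies the quadratic identity `h² = (2 − c) h − (1 − c) δ` and has the **explicit symmetric
positive square root**

  `E = h^{1/2} = (1 − θ) δ + θ h`,  `θ = √a/(1 + √a)`,  `a = 1 + φ = N⁻²`,

with inverse `E⁻¹ = (1 + θ') δ − θ' h`, `θ' = a/(1 + √a)`; both are polynomials in `h` with
coefficients smooth functions of `φ ≥ 0` (no eigen-decomposition and no `ℓ` — which a
`Background` leaves unconstrained where `φ = 0` — enter), hence smooth on all of `ℝ⁴`.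

This square root is the change of variables `q⃗ ↦ E q⃗` which turns the `3 + 1` first-order form
of the wave equation `□_g u = 0`, `A⁰ ∂_t V = Aᵏ ∂_k V + B V` with `A⁰ = diag(a, h, 1)` positive
definite and `Aᵏ` symmetric (John, *PDE*, Ch. 5 §3; module docstring of
`KerrSchildLapseShift.lean`), into a **symmetric hyperbolic system with `A⁰ = 1`**,
`∂_t W = 𝔄ᵏ ∂_k W + 𝔅 W`, `W = S V`, `S = diag(√a, E, 1)`, `𝔄ᵏ = S⁻¹ Aᵏ S⁻¹` — the format of
Friedrichs' existence theory (Friedrichs 1954; the tree's `Literature.Analysis.PDE.foOp`,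
`IsSymmCoeff`). This file is the pointwise algebra of that change of variables:

* `Background.invLapse` — `√a = (1 + φ)^{1/2} = 1/N ≥ 1`, smooth;
* `Background.sum_sliceInvMetric_mul_sliceInvMetric` — `h² = (2 − c) h − (1 − c) δ`;
* `Background.sliceSqrt`, `Background.sliceSqrtInv` — `E`, `E⁻¹`, symmetric and smooth, with
  `E² = h` (`sum_sliceSqrt_mul_sliceSqrt`), `E E⁻¹ = E⁻¹ E = δ`
  (`sum_sliceSqrt_mul_sliceSqrtInv`, `sum_sliceSqrtInv_mul_sliceSqrt`);
* the flat values: where `φ = 0`, `√a = 1`, `E = E⁻¹ = δ`.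

Everything is proved; no named fact and no `sorry` is introduced.

## References

* F. John, *Partial differential equations*, 4th ed., Springer 1982, Ch. 5, §3 (reduction of a
  second-order hyperbolic equation to a symmetric hyperbolic system). [John1982]
* K. O. Friedrichs, *Symmetric hyperbolic linear differential equations*, Comm. Pure Appl. Math.
  7 (1954) 345–392, §1. [Friedrichs1954]
* Y. Choquet-Bruhat, S. Cotsakis, J. Geom. Phys. 43 (2002) 345–350, §2 (the `3 + 1` form).
  [ChoquetbruhatCotsakis2002]
-/

noncomputable section

open Set Filter
open scoped ContDiff Topology

namespace Literature.Geometry.Lorentzian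

namespace KerrSchild

/-! ### Two algebraic identities for rank-one perturbations of the identity on `ℝ³` -/

/-- `(δ − c p pᵀ)² = δ − (2c − c² |p|²) p pᵀ`, entrywise. [folklore] -/
theorem sum_kronecker_sub_rankOne_mul_self (c : ℝ) (p : Fin 3 → ℝ) (j l : Fin 3) :
    ∑ k : Fin 3, ((if j = k then (1 : ℝ) else 0) - c * p j * p k) *
        ((if k = l then (1 : ℝ) else 0) - c * p k * p l) =
      (if j = l then 1 else 0) - (2 * c - c ^ 2 * ∑ k : Fin 3, p k ^ 2) * p j * p l := by
  have h1 : ∀ k : Fin 3, ((if j = k then (1 : ℝ) else 0) - c * p j * p k) *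
      ((if k = l then (1 : ℝ) else 0) - c * p k * p l) =
        (if j = k then ((if k = l then (1 : ℝ) else 0) - c * p k * p l) else 0) -
          (if k = l then c * p j * p k else 0) + c ^ 2 * p j * p l * p k ^ 2 := by
    intro k
    split_ifs <;> ring
  rw [Finset.sum_congr rfl fun k _ ↦ h1 k, Finset.sum_add_distrib, Finset.sum_sub_distrib,
    Finset.sum_ite_eq, Finset.sum_ite_eq', ← Finset.mul_sum]
  simp only [Finset.mem_univ, if_true]
  ring

/-- `(x δ + y (δ − c p pᵀ))` times `(x' δ + y' (δ − c p pᵀ))`, entrywise, for `|p|² = 1`: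
the product is `(x x') δ + (x y' + y x' + y y' (2 − c)) (δ − c p pᵀ) − y y' (1 − c) δ`, i.e. the
algebra `ℝ[h]/(h² − (2 − c) h + (1 − c))`. [folklore] -/
theorem sum_poly_rankOne_mul_poly_rankOne {c : ℝ} {p : Fin 3 → ℝ} (hS : ∑ k : Fin 3, p k ^ 2 = 1)
    (x y x' y' : ℝ) (j l : Fin 3) :
    ∑ k : Fin 3, (x * (if j = k then (1 : ℝ) else 0) +
        y * ((if j = k then (1 : ℝ) else 0) - c * p j * p k)) *
      (x' * (if k = l then (1 : ℝ) else 0) +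
        y' * ((if k = l then (1 : ℝ) else 0) - c * p k * p l)) =
      (x * x' - y * y' * (1 - c)) * (if j = l then 1 else 0) +
        (x * y' + y * x' + y * y' * (2 - c)) *
          ((if j = l then (1 : ℝ) else 0) - c * p j * p l) := by
  have h1 : ∀ k : Fin 3, (x * (if j = k then (1 : ℝ) else 0) +
        y * ((if j = k then (1 : ℝ) else 0) - c * p j * p k)) *
      (x' * (if k = l then (1 : ℝ) else 0) +
        y' * ((if k = l then (1 : ℝ) else 0) - c * p k * p l)) =
        (if j = k then (x + y) * (x' * (if k = l then (1 : ℝ) else 0) +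
          y' * ((if k = l then (1 : ℝ) else 0) - c * p k * p l)) else 0) -
          (if k = l then (x' + y') * (y * c * p j * p k) else 0) +
            y * y' * c ^ 2 * p j * p l * p k ^ 2 := by
    intro k
    split_ifs <;> ring
  rw [Finset.sum_congr rfl fun k _ ↦ h1 k, Finset.sum_add_distrib, Finset.sum_sub_distrib,
    Finset.sum_ite_eq, Finset.sum_ite_eq', ← Finset.mul_sum, hS]
  simp only [Finset.mem_univ, if_true]
  split_ifs <;> ring

namespace Background

variable (B : Background)

/-! ### The inverse lapse `√a = (1 + φ)^{1/2}` -/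

/-- The **inverse lapse** `1/N = √a = (1 + φ)^{1/2}` of the `3 + 1` form of `g = η + φ ℓ ⊗ ℓ`
(Choquet-Bruhat–Cotsakis 2002, §2, (2.2): `N = (1 + φ)^{-1/2}`).
[cite: ChoquetbruhatCotsakis2002, §2 (2.2)] -/
def invLapse (x : E4) : ℝ := Real.sqrt (B.invLapseSq x)

/-- Unfolding. [cite: ChoquetbruhatCotsakis2002, §2 (2.2)] -/
theorem invLapse_apply (x : E4) : B.invLapse x = Real.sqrt (B.invLapseSq x) := rfl

/-- `(√a)² = a`. [cite: ChoquetbruhatCotsakis2002, §2 (2.2)] -/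
theorem invLapse_sq (x : E4) : B.invLapse x ^ 2 = B.invLapseSq x :=
  Real.sq_sqrt (B.invLapseSq_pos x).le

/-- `√a · √a = a`. [cite: ChoquetbruhatCotsakis2002, §2 (2.2)] -/
theorem invLapse_mul_self (x : E4) : B.invLapse x * B.invLapse x = B.invLapseSq x := by
  rw [← sq, B.invLapse_sq]

/-- `1 ≤ √a` (`a ≥ 1`). [cite: ChoquetbruhatCotsakis2002, §2 (2.2)] -/
theorem one_le_invLapse (x : E4) : 1 ≤ B.invLapse x := by
  rw [invLapse, ← Real.sqrt_one]
  exact Real.sqrt_le_sqrt (B.one_le_invLapseSq x)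

/-- `0 < √a`. [cite: ChoquetbruhatCotsakis2002, §2 (2.2)] -/
theorem invLapse_pos (x : E4) : 0 < B.invLapse x := lt_of_lt_of_le one_pos (B.one_le_invLapse x)

/-- `0 < 1 + √a`. [cite: ChoquetbruhatCotsakis2002, §2 (2.2)] -/
theorem one_add_invLapse_pos (x : E4) : 0 < 1 + B.invLapse x := by
  linarith [B.invLapse_pos x]

/-- `√a` is smooth (`a ≥ 1 > 0`). [cite: ChoquetbruhatCotsakis2002, §2] -/
theorem contDiff_invLapse : ContDiff ℝ ∞ B.invLapse :=
  contDiff_iff_contDiffAt.2 fun x ↦ B.contDiff_invLapseSq.contDiffAt.sqrt (B.invLapseSq_pos x).ne'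

/-- `1/√a` is smooth. [cite: ChoquetbruhatCotsakis2002, §2] -/
theorem contDiff_inv_invLapse : ContDiff ℝ ∞ fun x ↦ (B.invLapse x)⁻¹ :=
  B.contDiff_invLapse.inv fun x ↦ (B.invLapse_pos x).ne'

/-- Where `φ = 0`: `√a = 1`. [cite: ChoquetbruhatCotsakis2002, §2 (2.2)] -/
theorem invLapse_of_eq_zero {x : E4} (hx : B.φ x = 0) : B.invLapse x = 1 := by
  rw [invLapse, invLapseSq_apply, hx, add_zero, Real.sqrt_one]

/-! ### The quadratic identity of the inverse slice metric -/

/-- The rank-one parameter `c = φ/(1 + φ) = 1 − 1/a ∈ [0, 1)` of `h = δ − c ℓ⃗ ⊗ ℓ⃗`.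
[cite: ChoquetbruhatCotsakis2002, §2 (2.1)] -/
def sliceDefect (x : E4) : ℝ := B.φ x / (1 + B.φ x)

/-- Unfolding. [cite: ChoquetbruhatCotsakis2002, §2 (2.1)] -/
theorem sliceDefect_apply (x : E4) : B.sliceDefect x = B.φ x / (1 + B.φ x) := rfl

/-- `1 − c = 1/a`. [cite: ChoquetbruhatCotsakis2002, §2 (2.1)] -/
theorem one_sub_sliceDefect (x : E4) : 1 - B.sliceDefect x = (B.invLapseSq x)⁻¹ := by
  have ha : (1 + B.φ x) ≠ 0 := by linarith [B.φ_nonneg x]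
  rw [sliceDefect, invLapseSq_apply]
  field_simp
  ring

/-- **`h² = (2 − c) h − (1 − c) δ`**: the inverse slice metric `h = δ − c ℓ⃗ ⊗ ℓ⃗` (`|ℓ⃗| = 1`
where `φ ≠ 0`) is annihilated by `(X − 1)(X − (1 − c))`. [cite: ChoquetbruhatCotsakis2002, §2 (2.1)] -/
theorem sum_sliceInvMetric_mul_sliceInvMetric (x : E4) (j l : Fin 3) :
    ∑ k : Fin 3, B.sliceInvMetric x j k * B.sliceInvMetric x k l =
      (2 - B.sliceDefect x) * B.sliceInvMetric x j l -
        (1 - B.sliceDefect x) * (if j = l then 1 else 0) := by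
  have h := sum_kronecker_sub_rankOne_mul_self (B.sliceDefect x) (fun k ↦ B.l x k.succ) j l
  simp only [B.sliceInvMetric_eq, ← B.sliceDefect_apply]
  refine h.trans ?_
  by_cases hx : B.φ x = 0
  · have hc : B.sliceDefect x = 0 := by rw [sliceDefect, hx, zero_div]
    simp only [hc]; ring
  · simp only [B.sum_sq_l_succ hx]; ring

/-! ### The square root `E = (1 − θ) δ + θ h` and its inverse -/

/-- The weight `θ = √a/(1 + √a) ∈ [1/2, 1)` of the square root `E = (1 − θ) δ + θ h`.
[cite: John1982, Ch. 5 §3] -/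
def sqrtWeight (x : E4) : ℝ := B.invLapse x / (1 + B.invLapse x)

/-- The weight `θ' = a/(1 + √a)` of the inverse square root `E⁻¹ = (1 + θ') δ − θ' h`.
[cite: John1982, Ch. 5 §3] -/
def sqrtWeight' (x : E4) : ℝ := B.invLapseSq x / (1 + B.invLapse x)

/-- Unfolding. [cite: John1982, Ch. 5 §3] -/
theorem sqrtWeight_apply (x : E4) : B.sqrtWeight x = B.invLapse x / (1 + B.invLapse x) := rfl

/-- Unfolding. [cite: John1982, Ch. 5 §3] -/
theorem sqrtWeight'_apply (x : E4) : B.sqrtWeight' x = B.invLapseSq x / (1 + B.invLapse x) := rfl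

/-- `θ` is smooth. [cite: John1982, Ch. 5 §3] -/
theorem contDiff_sqrtWeight : ContDiff ℝ ∞ B.sqrtWeight :=
  B.contDiff_invLapse.div (contDiff_const.add B.contDiff_invLapse)
    fun x ↦ (B.one_add_invLapse_pos x).ne'

/-- `θ'` is smooth. [cite: John1982, Ch. 5 §3] -/
theorem contDiff_sqrtWeight' : ContDiff ℝ ∞ B.sqrtWeight' :=
  B.contDiff_invLapseSq.div (contDiff_const.add B.contDiff_invLapse)
    fun x ↦ (B.one_add_invLapse_pos x).ne'

/-- Where `φ = 0`: `θ = 1/2`. [cite: John1982, Ch. 5 §3] -/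
theorem sqrtWeight_of_eq_zero {x : E4} (hx : B.φ x = 0) : B.sqrtWeight x = 1 / 2 := by
  rw [sqrtWeight, B.invLapse_of_eq_zero hx]; norm_num

/-- Where `φ = 0`: `θ' = 1/2`. [cite: John1982, Ch. 5 §3] -/
theorem sqrtWeight'_of_eq_zero {x : E4} (hx : B.φ x = 0) : B.sqrtWeight' x = 1 / 2 := by
  rw [sqrtWeight', B.invLapse_of_eq_zero hx, invLapseSq_apply, hx]; norm_num

/-- The **square root of the inverse slice metric**, `E = h^{1/2} = (1 − θ) δ + θ h`,
`θ = √a/(1 + √a)`: the symmetric positive definite matrix with `E² = h`, written as a polynomial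
in `h` (so smooth where `h` is). It is the change of variables `q⃗ ↦ E q⃗` symmetrising the
`3 + 1` first-order form of the wave equation (John, *PDE*, Ch. 5 §3).
[cite: John1982, Ch. 5 §3] -/
def sliceSqrt (x : E4) (j k : Fin 3) : ℝ :=
  (1 - B.sqrtWeight x) * (if j = k then 1 else 0) + B.sqrtWeight x * B.sliceInvMetric x j k

/-- The **inverse square root of the inverse slice metric**, `E⁻¹ = h^{-1/2} = (1 + θ') δ − θ' h`,
`θ' = a/(1 + √a)`. [cite: John1982, Ch. 5 §3] -/
def sliceSqrtInv (x : E4) (j k : Fin 3) : ℝ :=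
  (1 + B.sqrtWeight' x) * (if j = k then 1 else 0) + (-B.sqrtWeight' x) * B.sliceInvMetric x j k

/-- Unfolding of `E`. [cite: John1982, Ch. 5 §3] -/
theorem sliceSqrt_apply (x : E4) (j k : Fin 3) :
    B.sliceSqrt x j k =
      (1 - B.sqrtWeight x) * (if j = k then 1 else 0) + B.sqrtWeight x * B.sliceInvMetric x j k :=
  rfl

/-- Unfolding of `E⁻¹`. [cite: John1982, Ch. 5 §3] -/
theorem sliceSqrtInv_apply (x : E4) (j k : Fin 3) :
    B.sliceSqrtInv x j k =
      (1 + B.sqrtWeight' x) * (if j = k then 1 else 0) +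
        (-B.sqrtWeight' x) * B.sliceInvMetric x j k :=
  rfl

/-- `E` is symmetric. [cite: John1982, Ch. 5 §3] -/
theorem sliceSqrt_symm (x : E4) (j k : Fin 3) : B.sliceSqrt x j k = B.sliceSqrt x k j := by
  rw [sliceSqrt, sliceSqrt, B.sliceInvMetric_symm x j k]
  by_cases h : j = k
  · subst h; rfl
  · simp [h, Ne.symm h]

/-- `E⁻¹` is symmetric. [cite: John1982, Ch. 5 §3] -/
theorem sliceSqrtInv_symm (x : E4) (j k : Fin 3) : B.sliceSqrtInv x j k = B.sliceSqrtInv x k j := by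
  rw [sliceSqrtInv, sliceSqrtInv, B.sliceInvMetric_symm x j k]
  by_cases h : j = k
  · subst h; rfl
  · simp [h, Ne.symm h]

/-- `E` is smooth. [cite: John1982, Ch. 5 §3] -/
theorem contDiff_sliceSqrt (j k : Fin 3) : ContDiff ℝ ∞ fun x ↦ B.sliceSqrt x j k :=
  ((contDiff_const.sub B.contDiff_sqrtWeight).mul contDiff_const).add
    (B.contDiff_sqrtWeight.mul (B.contDiff_sliceInvMetric j k))

/-- `E⁻¹` is smooth. [cite: John1982, Ch. 5 §3] -/
theorem contDiff_sliceSqrtInv (j k : Fin 3) : ContDiff ℝ ∞ fun x ↦ B.sliceSqrtInv x j k :=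
  ((contDiff_const.add B.contDiff_sqrtWeight').mul contDiff_const).add
    (B.contDiff_sqrtWeight'.neg.mul (B.contDiff_sliceInvMetric j k))

/-- Where `φ = 0`: `E = δ`. [cite: John1982, Ch. 5 §3] -/
theorem sliceSqrt_of_eq_zero {x : E4} (hx : B.φ x = 0) (j k : Fin 3) :
    B.sliceSqrt x j k = if j = k then 1 else 0 := by
  rw [sliceSqrt, B.sqrtWeight_of_eq_zero hx, B.sliceInvMetric_eq, hx]
  ring

/-- Where `φ = 0`: `E⁻¹ = δ`. [cite: John1982, Ch. 5 §3] -/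
theorem sliceSqrtInv_of_eq_zero {x : E4} (hx : B.φ x = 0) (j k : Fin 3) :
    B.sliceSqrtInv x j k = if j = k then 1 else 0 := by
  rw [sliceSqrtInv, B.sqrtWeight'_of_eq_zero hx, B.sliceInvMetric_eq, hx]
  ring

/-- The multiplication table of the algebra `ℝ[h]`: for scalars `x, y, x', y'`,
`∑_k (x δ + y h)_{jk} (x' δ + y' h)_{kl} = (x x' − y y' (1 − c)) δ_{jl} + (x y' + y x' + y y'(2 − c)) h_{jl}`.
[cite: ChoquetbruhatCotsakis2002, §2 (2.1)] -/
theorem sum_poly_sliceInvMetric_mul (pt : E4) (x y x' y' : ℝ) (j l : Fin 3) :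
    ∑ k : Fin 3, (x * (if j = k then (1 : ℝ) else 0) + y * B.sliceInvMetric pt j k) *
        (x' * (if k = l then (1 : ℝ) else 0) + y' * B.sliceInvMetric pt k l) =
      (x * x' - y * y' * (1 - B.sliceDefect pt)) * (if j = l then 1 else 0) +
        (x * y' + y * x' + y * y' * (2 - B.sliceDefect pt)) * B.sliceInvMetric pt j l := by
  by_cases hx : B.φ pt = 0
  · have hc : B.sliceDefect pt = 0 := by rw [sliceDefect, hx, zero_div]
    have hh : ∀ j k : Fin 3, B.sliceInvMetric pt j k = if j = k then 1 else 0 := fun j k ↦ by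
      rw [B.sliceInvMetric_eq, hx]; ring
    simp only [hh, hc]
    have h1 : ∀ k : Fin 3, (x * (if j = k then (1 : ℝ) else 0) + y * if j = k then 1 else 0) *
        (x' * (if k = l then (1 : ℝ) else 0) + y' * if k = l then 1 else 0) =
          if j = k then (x + y) * ((x' + y') * if k = l then 1 else 0) else 0 := by
      intro k; split_ifs <;> ring
    rw [Finset.sum_congr rfl fun k _ ↦ h1 k, Finset.sum_ite_eq]
    simp only [Finset.mem_univ, if_true]
    split_ifs <;> ring
  · simp only [B.sliceInvMetric_eq, ← B.sliceDefect_apply]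
    exact sum_poly_rankOne_mul_poly_rankOne (B.sum_sq_l_succ hx) x y x' y' j l

/-- The defining relation of the weight: `(1 − θ)² = θ² (1 − c)` (i.e. `θ = 1/(1 + √(1 − c))`,
`√(1 − c) = 1/√a`). [cite: John1982, Ch. 5 §3] -/
theorem one_sub_sqrtWeight_sq (x : E4) :
    (1 - B.sqrtWeight x) ^ 2 = B.sqrtWeight x ^ 2 * (1 - B.sliceDefect x) := by
  have hr : 0 < B.invLapse x := B.invLapse_pos x
  have h1 : (1 + B.invLapse x) ≠ 0 := (B.one_add_invLapse_pos x).ne'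
  have ha : B.invLapseSq x = B.invLapse x ^ 2 := (B.invLapse_sq x).symm
  rw [B.one_sub_sliceDefect, sqrtWeight, ha]
  field_simp
  ring

/-- **`E² = h`**: `E = (1 − θ) δ + θ h` is a square root of the inverse slice metric.
[cite: John1982, Ch. 5 §3] -/
theorem sum_sliceSqrt_mul_sliceSqrt (x : E4) (j l : Fin 3) :
    ∑ k : Fin 3, B.sliceSqrt x j k * B.sliceSqrt x k l = B.sliceInvMetric x j l := by
  simp only [B.sliceSqrt_apply]
  rw [B.sum_poly_sliceInvMetric_mul]
  have hθ := B.one_sub_sqrtWeight_sq x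
  have hI : (1 - B.sqrtWeight x) * (1 - B.sqrtWeight x) -
      B.sqrtWeight x * B.sqrtWeight x * (1 - B.sliceDefect x) = 0 := by nlinarith [hθ]
  have hH : (1 - B.sqrtWeight x) * B.sqrtWeight x + B.sqrtWeight x * (1 - B.sqrtWeight x) +
      B.sqrtWeight x * B.sqrtWeight x * (2 - B.sliceDefect x) = 1 := by nlinarith [hθ]
  rw [hI, hH]; ring

/-- The defining relation of the inverse weight: `θ' = θ + c θ θ'` (i.e. `θ' = θ/(1 − c θ)`,
`1 − c θ = 1/√a`). [cite: John1982, Ch. 5 §3] -/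
theorem sqrtWeight'_eq (x : E4) :
    B.sqrtWeight' x = B.sqrtWeight x + B.sliceDefect x * B.sqrtWeight x * B.sqrtWeight' x := by
  have hr : 0 < B.invLapse x := B.invLapse_pos x
  have h1 : (1 + B.invLapse x) ≠ 0 := (B.one_add_invLapse_pos x).ne'
  have ha : B.invLapseSq x = B.invLapse x ^ 2 := (B.invLapse_sq x).symm
  have hc : B.sliceDefect x = 1 - (B.invLapseSq x)⁻¹ := by rw [← B.one_sub_sliceDefect x]; ring
  rw [hc, sqrtWeight, sqrtWeight', ha]
  field_simp
  ring

/-- **`E E⁻¹ = δ`**. [cite: John1982, Ch. 5 §3] -/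
theorem sum_sliceSqrt_mul_sliceSqrtInv (x : E4) (j l : Fin 3) :
    ∑ k : Fin 3, B.sliceSqrt x j k * B.sliceSqrtInv x k l = if j = l then 1 else 0 := by
  simp only [B.sliceSqrt_apply, B.sliceSqrtInv_apply]
  rw [B.sum_poly_sliceInvMetric_mul]
  have hθ' := B.sqrtWeight'_eq x
  have hH : (1 - B.sqrtWeight x) * -B.sqrtWeight' x + B.sqrtWeight x * (1 + B.sqrtWeight' x) +
      B.sqrtWeight x * -B.sqrtWeight' x * (2 - B.sliceDefect x) = 0 := by linear_combination -hθ'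
  have hI : (1 - B.sqrtWeight x) * (1 + B.sqrtWeight' x) -
      B.sqrtWeight x * -B.sqrtWeight' x * (1 - B.sliceDefect x) = 1 := by linear_combination hθ'
  rw [hI, hH]; ring

/-- **`E⁻¹ E = δ`**. [cite: John1982, Ch. 5 §3] -/
theorem sum_sliceSqrtInv_mul_sliceSqrt (x : E4) (j l : Fin 3) :
    ∑ k : Fin 3, B.sliceSqrtInv x j k * B.sliceSqrt x k l = if j = l then 1 else 0 := by
  simp only [B.sliceSqrt_apply, B.sliceSqrtInv_apply]
  rw [B.sum_poly_sliceInvMetric_mul]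
  have hθ' := B.sqrtWeight'_eq x
  have hH : (1 + B.sqrtWeight' x) * B.sqrtWeight x + -B.sqrtWeight' x * (1 - B.sqrtWeight x) +
      -B.sqrtWeight' x * B.sqrtWeight x * (2 - B.sliceDefect x) = 0 := by linear_combination -hθ'
  have hI : (1 + B.sqrtWeight' x) * (1 - B.sqrtWeight x) -
      -B.sqrtWeight' x * B.sqrtWeight x * (1 - B.sliceDefect x) = 1 := by linear_combination hθ'
  rw [hI, hH]; ring

/-- `E⁻¹ h E⁻¹ = δ` in the form `∑_{k m} E⁻¹_{jk} h_{km} E⁻¹_{ml} = δ_{jl}` (`h = E E`).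
[cite: John1982, Ch. 5 §3] -/
theorem sum_sum_sliceSqrtInv_mul_sliceInvMetric_mul_sliceSqrtInv (x : E4) (j l : Fin 3) :
    ∑ k : Fin 3, ∑ m : Fin 3, B.sliceSqrtInv x j k * B.sliceInvMetric x k m * B.sliceSqrtInv x m l =
      if j = l then 1 else 0 := by
  have h1 : ∀ k m : Fin 3, B.sliceSqrtInv x j k * B.sliceInvMetric x k m * B.sliceSqrtInv x m l =
      ∑ n : Fin 3, B.sliceSqrtInv x j k * B.sliceSqrt x k n * (B.sliceSqrt x n m * B.sliceSqrtInv x m l) := by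
    intro k m
    rw [← B.sum_sliceSqrt_mul_sliceSqrt x k m, Finset.mul_sum, Finset.sum_mul]
    exact Finset.sum_congr rfl fun n _ ↦ by ring
  simp_rw [h1]
  rw [Finset.sum_congr rfl fun k _ ↦ Finset.sum_comm]
  have h2 : ∀ k n : Fin 3, ∑ m : Fin 3, B.sliceSqrtInv x j k * B.sliceSqrt x k n *
      (B.sliceSqrt x n m * B.sliceSqrtInv x m l) =
        B.sliceSqrtInv x j k * B.sliceSqrt x k n * (if n = l then 1 else 0) := by
    intro k n
    rw [← Finset.mul_sum, B.sum_sliceSqrt_mul_sliceSqrtInv]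
  simp_rw [h2]
  rw [Finset.sum_comm]
  simp_rw [← Finset.sum_mul, B.sum_sliceSqrtInv_mul_sliceSqrt]
  by_cases hjl : j = l
  · subst hjl; simp
  · simp [hjl]

end Background

end KerrSchild

end Literature.Geometry.Lorentzian

end
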